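import Summits.QuantumFields.BalabanUV.T4Continuum.Support.B13StepEndArithmetic
import Summits.QuantumFields.BalabanUV.T4Continuum.Support.B13ReadingsRecord

/-!
# B13StepEndInsOpBalaban — NE5 ∕ U3: the termwise END face OF RECORD with W4 produced (`B13StepEndInsOp`), READ AT BAŁABAN's TIER-B
# BACKGROUND — W1 PRODUCED by the row owner's `B13ReadingsRecord` (p224830: the background-generic twin of `B13ReadingsAssembly` p222372 and
# its RECORD FACE) BY NAME, the arithmetic letters ELIMINATED by `B13StepEndArithmetic` (p210647) BY NAME; per assembly, per pair of runs, η-UNIFORMLY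

Cell `pub-balaban`, unit `b2b-balaban-t4-ne5-formalise-leaf-10-g8` (NE5 formalisation swarm, LEAF PROVER 10, gen 8; lineage FOLLOWER under CLAIM RULE 1∕3: a NEW module
APPLYING this lineage's landed END faces BY NAME; journal INTENT l.15815, owner RULING R50 = GO «on the twin road» l.16073, ACK l.16274).  Imports `B13StepEndArithmetic`
and the owner's `B13ReadingsRecord`; edits nothing; defines NO species reading (R41).  Summits-side new work under the LEAN PLACEMENT RULE (bookkeeping; 0 cite tags —
printed KIND only).  HONEST FRAMING: rung (B)+1 of the FINITE-VOLUME T⁴ continuum programme — NOT infinite volume, NOT a mass gap, NOT the Clay problem, and **NOT A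
PROOF OF NE5** (NOT PRINTED: the series prints ε-UNIFORM bounds, never η-RATES; cell GAPS G-t4-U3-1), NOT a proof of NE2 or NE3: every theorem is an IMPLICATION whose
wall binders are DISPLAYED HYPOTHESES asserted nowhere.  HONEST DEPENDENCY (cell line, verbatim): continuum YM on T⁴ ⇐ BetaPertH ∧ nine spine estimates (0/9 proved);
BetaPertH ⇐ (D1) ∧ (D4) ∧ CAP+tail; G-an2-4 gates asym, D1 and NE2/3/4.

WHAT THIS FILE DOES (compositions BY NAME; no analytic estimate of its own).  Background (leaf-04-g8's located fact F-ne5leaf04g8-1 ∕ C-ne5leaf04-8; owner R50):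
the carriers OF RECORD have `BgB = ↥R.admB`, so W1 of record is read from the owner's background-generic faces, towers `tow : ℕ → (ℕ → ℝ) → BgB → ↥dom` (the
reading map IS the chart into node U1b's admissible data), run A's species read at the transported background.  DISPLAYED on every face below, replacing `hwer`:
node U1b's `NE3Shape (minActReadings d 𝒞 L N dom (ne2Loc …)) Cn θ` (OPEN, row NE3), the (3.35)-class `hreg`, `0 ≤ α, β, Cn`, the threshold `α, β ≤ η ≤ etaStar`, the
O1 LETTERS of the five species (decay `hdec∕hdecΦ∕hdecΨ`, op-Lipschitz `hΦ∕hS₂`, `hΨ∕hS₃`, tower readings `ReadsTowerCov∕Delta∕GammaA∕B`, dominations, `PotQ∕PotRLipschitzReading`,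
`Λ₂, …, Λ₅ ≥ 0`) and the two slot lines `hSA : rawA = kernel ∘ rawA₀`, `hSB : rawB = kernel ∘ rawB₀` (`rfl` at the substrate's `slotsOfRecord`); input rate `Θ := √(max θ L⁻¹)`
(`sqrt_rate_pos_lt_one`: `0 < Θ < 1` from `2 ≤ L` and `NE3Shape.rate_lt_one` — no rate binder; `c1_balaban_nonneg` discharges `hc₁`); W4's species rate displayed at `Θ`.
* §1 `exists_ne5_of_assembly_insOp_balaban_ne3Shape` — ANY carriers `C`, assembly `𝔄 : B13Represents.Assembly C (Species …) IOp Hist ι P J`: this lineage's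
  letters-free END `B13StepEndArithmetic.exists_ne5_of_assembly_insOp` fed by the owner's twin `weightedEntrywiseRate_balaban_ne3Shape′` at `Bg′ := C.BgB`;
  conclusion `∃ C₅, T4OutputRate.NE5 (𝔄.outA (𝔄.bHist E₀ cB)) (𝔄.outB (𝔄.bHist E₀ cB)) W κ θ′ C₅`.
* §2 ON THE CARRIERS OF RECORD (`R : TwoRuns 𝔾`, `S : Slots R (Species …) IOp Hist`), fed by the owner's RECORD FACE `weightedEntrywiseRate_record_balaban_ne3Shape`:
  `exists_ne5_of_record_insOp_balaban_ne3Shape` (per pair of runs; conclusion LITERALLY `∃ C₅, NE5 (outA S E₀ cB) (outB S E₀ cB) W κ θ′ C₅`) and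
  `uniform_ne5_of_record_insOp_balaban_ne3Shape` — ONE `C₅` from the SIZES ONLY (`κ` aside: `G, EA₀, E₀, cA, cB, r₀, Gi, δI, θ′, ω`, the letters of W1's constant
  `o, d, L, a, α, β, Cn, a′, B₁, B₂, B₃, Λ₂, …, Λ₅`, U1b's rate letter `θ < 1`) for EVERY pair of runs, slot package with `S.D.ω = ω`, species tables, towers, admissible
  data `dom ∕ 𝒞 ∕ N ∕ RgV` in U1b's shape at `(Cn, θ)`, window, margins and roomy class — the η-UNIFORMITY visible in the quantifier order `∃ C₅, ∀ …`.
So on the END-of-record road, as on the tower road (`OutputRateTowerArithmetic` §3), the terminal face displays ONLY `NE3Shape` + class ∕ threshold + O1 letters + slot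
lines + `TransportReads` + W3 slice budgets + L05∕L06 + `RawBounded` ×2 + floor + W2-ins envelope ∕ bound + the species' two-run rate + termwise W2 data + rooms + signs and
the TWO STRICT SIZE INEQUALITIES `cA(EA₀ + E₀) < 1 − ω`, `ω + G·cA·(1 − ω)∕(1 − ω − cA(EA₀ + E₀)) < θ′` — no `hwer`, no rate binder, no `ρ₀ ∕ k₀ ∕ B ∕ ρ₁ ∕ k₁`, no chart.
NOT decided here (census): whether Bałaban's constants satisfy the two inequalities (every letter O(1)-symbolic in print; `B13SmallnessCensus.md`); 0∕12 leaves on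
Bałaban's concrete objects (O1 = substrate cell); spine 0∕9.  `FlowStep.BetaPertH`, (B), (B^μ) do not occur.  0 sorry; no new axioms.
-/

noncomputable section

open scoped Matrix.Norms.L2Operator
open Metric Set

namespace Summit.QuantumFields.BalabanUV.T4Continuum.B13StepEndInsOpBalaban

open Literature.MathematicalPhysics.QuantumFieldTheory.Balaban1983to89
open Literature.MathematicalPhysics.QuantumFieldTheory.Balaban1983to89.T4OutputRate (Carriers Functional DecayBound NE5)
open Literature.MathematicalPhysics.QuantumFieldTheory.Balaban1983to89.T4InputCauchyRateData (StepModel)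
open Literature.MathematicalPhysics.QuantumFieldTheory.Balaban1983to89.T4InputCauchyRateSpecies (ballClass)
open Literature.MathematicalPhysics.QuantumFieldTheory.Balaban1983to89.T4InputCauchyRateTermwise
  (TermBound TermBudget TermLineAnalytic)
open Literature.MathematicalPhysics.QuantumFieldTheory.Balaban1983to89.B5Prop11Plancherel (Cst Tor fine)
open Literature.MathematicalPhysics.QuantumFieldTheory.Balaban1983to89.B5G183RateUnitTower (lev lev_neZero)
open Literature.MathematicalPhysics.QuantumFieldTheory.Balaban1983to89.T4EtaRateMin (NE3Shape)
open Summit.QuantumFields.BalabanUV.T4Continuum.B13Carriers (TwoRuns)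
open Summit.QuantumFields.BalabanUV.T4Continuum.B13OpDatum (OpDatum Format Species RawSpecies)
open Summit.QuantumFields.BalabanUV.T4Continuum.B13OpDatumJunctions (RawBounded WeightedEntrywiseRate)
open Summit.QuantumFields.BalabanUV.T4Continuum.B13StepTermLabels (TermIdx InnerLabel)
open Summit.QuantumFields.BalabanUV.T4Continuum.B13StepTermFamily (term)
open Summit.QuantumFields.BalabanUV.T4Continuum.B13InnerData (Bnd)
open Summit.QuantumFields.BalabanUV.T4Continuum.B13Base (selfCtr)
open Summit.QuantumFields.BalabanUV.T4Continuum.B13Represents (Assembly)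
open Summit.QuantumFields.BalabanUV.T4Continuum.B13StepOfRecord (Slots assembly step outA outB)
open Summit.QuantumFields.BalabanUV.T4Continuum.B13StepEndArithmetic (exists_ne5_of_assembly_insOp exists_ne5_of_record_insOp)
open Summit.QuantumFields.BalabanUV.T4Continuum.B13ReadingsDecay (ReadsTowerCovA ReadsTowerCovB CovWeightDominatesDist)
open Summit.QuantumFields.BalabanUV.T4Continuum.B13ReadingsImage
open Summit.QuantumFields.BalabanUV.T4Continuum.B13ReadingsLocal (PotQLipschitzReading PotRLipschitzReading)
open Summit.QuantumFields.BalabanUV.T4Continuum.B13ReadingsAssembly (CpertRec)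
open Summit.QuantumFields.BalabanUV.T4Continuum.B13ReadingsRecord
  (weightedEntrywiseRate_balaban_ne3Shape' weightedEntrywiseRate_record_balaban_ne3Shape)
open Summit.QuantumFields.BalabanUV.T4Continuum.DecayRateInterpolation (EntryDecay)
open Summit.QuantumFields.BalabanUV.T4Continuum.BalabanAveragedTowerUnit (idx)
open Summit.QuantumFields.BalabanUV.T4Continuum.GaugeTermScalarData (QuT Q1)
open Summit.QuantumFields.BalabanUV.T4Continuum.RegularSiteTransporters (siteT)
open Summit.QuantumFields.BalabanUV.T4Continuum.RegularBackgroundTower (RegularTransporters)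
open Summit.QuantumFields.BalabanUV.T4Continuum.NE2ColourPerturbedLayer (pertCovC)
open Summit.QuantumFields.BalabanUV.T4Continuum.NE2BalabanRoot (balabanPert)
open Summit.QuantumFields.BalabanUV.T4Continuum.NE2BalabanGauge (gaugeSlot liftR)
open Summit.QuantumFields.BalabanUV.T4Continuum.NE2BalabanThreshold (etaStar)
open Summit.QuantumFields.BalabanUV.T4Continuum.NE2FromNE3Carrier (ne2Loc)
open Summit.QuantumFields.BalabanUV.T4Continuum.MinimalActionRate (minActReadings)

section Balaban

variable {d : ℕ} (L : ℕ) {o : Type*} [Fintype o] [DecidableEq o] (a : ℝ) {α β Cn a' η θ : ℝ}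

/-! ## §1 The END face on the assembled model, W1 produced at Bałaban's tier-B background, letters eliminated -/

/-- [folklore] The W1 supplier's input rate is honest: `0 < √(max θ L⁻¹) < 1` from `2 ≤ L` and `θ < 1` (`NE3Shape.rate_lt_one`); no binder. -/
theorem sqrt_rate_pos_lt_one (hL : 2 ≤ L) (hθ1 : θ < 1) :
    0 < Real.sqrt (max θ ((L : ℝ)⁻¹)) ∧ Real.sqrt (max θ ((L : ℝ)⁻¹)) < 1 := by
  have hL1 : (1 : ℝ) < L := by exact_mod_cast (lt_of_lt_of_le one_lt_two hL : 1 < L)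
  have hlt : max θ ((L : ℝ)⁻¹) < 1 := max_lt hθ1 (inv_lt_one_of_one_lt₀ hL1)
  have h0 : 0 < max θ ((L : ℝ)⁻¹) := lt_max_of_lt_right (inv_pos.mpr (by linarith))
  exact ⟨Real.sqrt_pos.mpr h0, by rw [show (1 : ℝ) = Real.sqrt 1 from Real.sqrt_one.symm]; exact Real.sqrt_lt_sqrt h0.le hlt⟩
/-- [folklore] W1's constant produced by the owner's assembly is a size (nonnegative). -/
theorem c1_balaban_nonneg (hC : 0 ≤ Cn) {B₁ B₂ B₃ Λ₂ Λ₃ Λ₄ Λ₅ : ℝ} (hΛ₄ : 0 ≤ Λ₄) (hΛ₅ : 0 ≤ Λ₅) :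
    0 ≤ Real.sqrt (2 * B₁ * (2 * CpertRec o d L a α β Cn a' / (1 - max θ ((L : ℝ)⁻¹)))) +
        Real.sqrt (2 * B₂ * (Λ₂ * CpertRec o d L a α β Cn a')) + Real.sqrt (2 * B₃ * (Λ₃ * CpertRec o d L a α β Cn a')) +
        Λ₄ * Cn + Λ₅ * Cn := by positivity

variable [NeZero L] (Mf : Fin d → ℕ) [hM : ∀ μ, NeZero (Mf μ)] (ha : 0 < a) {Ts Ks Is Ωs Ys m : Type*} [Fintype m] [DecidableEq m]
variable {𝒞 : ℕ → Set (B7Prop1Explicit.Site d → Fin d → (Matrix o o ℂ)ˣ)} {N : ℕ}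
  {dom : Set (B7Prop1Explicit.Site d → Fin d → (Matrix o o ℂ)ˣ)}
  {RgV : (B7Prop1Explicit.Site d → Fin d → (Matrix o o ℂ)ˣ) → ((k : ℕ) → Fin d → (Tor (fine (lev L k) Mf) → Matrix o o ℂ))}

variable {C : Carriers} {IOp Hist ι P J : Type*} [NormedAddCommGroup Hist] [NormedSpace ℂ Hist] [CompleteSpace Hist]
  [NormedAddCommGroup IOp] [NormedSpace ℂ IOp]

/-- [folklore] **THE TERMWISE END FACE WITH W4 PRODUCED ON THE ASSEMBLED MODEL, W1 PRODUCED AT BAŁABAN's TIER-B BACKGROUND, ARITHMETIC LETTERS ELIMINATED**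
— `B13StepEndArithmetic.exists_ne5_of_assembly_insOp` for any assembly `𝔄` on any carriers `C` with species entries, `hwer ∕ hc₁ ∕ hθ0 ∕ hθ1` REPLACED by the slot
lines `hSA`∕`hSB` and the owner's `weightedEntrywiseRate_balaban_ne3Shape′` inputs VERBATIM at `Fk := 𝔄.F`, `Bg′ := C.BgB` (run A read at `C.transport U`).  Input rate
`√(max θ L⁻¹)`; conclusion at the PRESCRIBED `θ′`.  NOT a proof of NE5 ∕ NE2 ∕ NE3: an implication from displayed binders. -/
theorem exists_ne5_of_assembly_insOp_balaban_ne3Shape (𝔄 : Assembly C (Species Ts Ks Is Ωs Ys) IOp Hist ι P J) (hL : 2 ≤ L)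
    (hd : 1 ≤ d) (hreg : ∀ V ∈ dom, RegularTransporters L Mf (liftR L Mf (RgV V)) α β) (hα : 0 ≤ α) (hβ : 0 ≤ β) (hC : 0 ≤ Cn)
    (hNE3 : NE3Shape (minActReadings d 𝒞 L N dom (ne2Loc L Mf fun V => liftR L Mf (RgV V))) Cn θ)
    (ha' : 0 < a') (hαη : α ≤ η) (hβη : β ≤ η) (hη : η ≤ etaStar o d a a')
    -- the species tables of the two runs and the two slot identifications ([dict], displayed; `rfl` at the substrate's `slotsOfRecord`)
    {rawA₀ : (ℕ → ℝ) → C.BgA → ℕ → RawSpecies Ts Ks Is Ωs Ys} {rawB₀ : (ℕ → ℝ) → C.BgB → ℕ → RawSpecies Ts Ks Is Ωs Ys}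
    (hSA : ∀ g V k, 𝔄.rawA g V k = (rawA₀ g V k).kernel) (hSB : ∀ g U k, 𝔄.rawB g U k = (rawB₀ g U k).kernel)
    -- the towers over the model's run-B background type (the reading map IS the chart into node NE3's admissible data)
    {tow : ℕ → (ℕ → ℝ) → C.BgB → ↥dom} {W : Set (ℕ → ℝ)}
    -- the covariance species
    {σ : Ts → Ks → idx L Mf 0 × o} {dist₁ : idx L Mf 0 × o → idx L Mf 0 × o → ℝ} {B₁ δ₁ : ℝ}
    (hdec : ∀ V ∈ dom, ∀ k, EntryDecay dist₁
      (pertCovC L Mf a ha (balabanPert L Mf a (liftR L Mf (RgV V)) (gaugeSlot L Mf (RgV V) (QuT L Mf o (siteT L Mf (RgV V))) (Q1 L Mf o) a'))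
        1 k) B₁ δ₁)
    (hcovA : ReadsTowerCovA
      (fun V : ↥dom => pertCovC L Mf a ha
        (balabanPert L Mf a (liftR L Mf (RgV V)) (gaugeSlot L Mf (RgV V) (QuT L Mf o (siteT L Mf (RgV V))) (Q1 L Mf o) a')) 1)
      σ tow (fun g U k => rawA₀ g (C.transport U) k) W)
    (hcovB : ReadsTowerCovB
      (fun V : ↥dom => pertCovC L Mf a ha
        (balabanPert L Mf a (liftR L Mf (RgV V)) (gaugeSlot L Mf (RgV V) (QuT L Mf o (siteT L Mf (RgV V))) (Q1 L Mf o) a')) 1)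
      σ tow rawB₀ W)
    (hdom₁ : CovWeightDominatesDist 𝔄.F dist₁ σ (δ₁ / 2))
    -- the `deltaKer` species
    {S₂ : Set (Matrix (idx L Mf 0 × o) (idx L Mf 0 × o) ℂ)} {Φ : Ts → Matrix (idx L Mf 0 × o) (idx L Mf 0 × o) ℂ → Matrix m m ℂ}
    {Λ₂ : ℝ} (hΦ : ∀ t, OpLipschitzOn S₂ (Φ t) Λ₂) (hΛ₂ : 0 ≤ Λ₂)
    (hS₂ : ∀ V ∈ dom, ∀ k, pertCovC L Mf a ha
      (balabanPert L Mf a (liftR L Mf (RgV V)) (gaugeSlot L Mf (RgV V) (QuT L Mf o (siteT L Mf (RgV V))) (Q1 L Mf o) a')) 1 k ∈ S₂)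
    {dist₂ : m → m → ℝ} {B₂ δ₂ : ℝ}
    (hdecΦ : ∀ V ∈ dom, ∀ t k, EntryDecay dist₂ (Φ t (pertCovC L Mf a ha
      (balabanPert L Mf a (liftR L Mf (RgV V)) (gaugeSlot L Mf (RgV V) (QuT L Mf o (siteT L Mf (RgV V))) (Q1 L Mf o) a')) 1 k)) B₂ δ₂)
    {σX : Ts → Is → m}
    (hΔA : ReadsTowerDeltaA (fun (V : ↥dom) t k => Φ t (pertCovC L Mf a ha
      (balabanPert L Mf a (liftR L Mf (RgV V)) (gaugeSlot L Mf (RgV V) (QuT L Mf o (siteT L Mf (RgV V))) (Q1 L Mf o) a')) 1 k))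
      σX tow (fun g U k => rawA₀ g (C.transport U) k) W)
    (hΔB : ReadsTowerDeltaB (fun (V : ↥dom) t k => Φ t (pertCovC L Mf a ha
      (balabanPert L Mf a (liftR L Mf (RgV V)) (gaugeSlot L Mf (RgV V) (QuT L Mf o (siteT L Mf (RgV V))) (Q1 L Mf o) a')) 1 k))
      σX tow rawB₀ W)
    (hdom₂ : DeltaWeightDominatesDist 𝔄.F dist₂ σX (δ₂ / 2))
    -- the `gammaConstituent` species
    {S₃ : Set (Matrix (idx L Mf 0 × o) (idx L Mf 0 × o) ℂ)} {Ψ : Ts → Matrix (idx L Mf 0 × o) (idx L Mf 0 × o) ℂ → Matrix m m ℂ}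
    {Λ₃ : ℝ} (hΨ : ∀ t, OpLipschitzOn S₃ (Ψ t) Λ₃) (hΛ₃ : 0 ≤ Λ₃)
    (hS₃ : ∀ V ∈ dom, ∀ k, pertCovC L Mf a ha
      (balabanPert L Mf a (liftR L Mf (RgV V)) (gaugeSlot L Mf (RgV V) (QuT L Mf o (siteT L Mf (RgV V))) (Q1 L Mf o) a')) 1 k ∈ S₃)
    {dist₃ : m → m → ℝ} {B₃ δ₃ : ℝ}
    (hdecΨ : ∀ V ∈ dom, ∀ t k, EntryDecay dist₃ (Ψ t (pertCovC L Mf a ha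
      (balabanPert L Mf a (liftR L Mf (RgV V)) (gaugeSlot L Mf (RgV V) (QuT L Mf o (siteT L Mf (RgV V))) (Q1 L Mf o) a')) 1 k)) B₃ δ₃)
    {σB : Ts → Ks → m}
    (hΓA : ReadsTowerGammaA (fun (V : ↥dom) t k => Ψ t (pertCovC L Mf a ha
      (balabanPert L Mf a (liftR L Mf (RgV V)) (gaugeSlot L Mf (RgV V) (QuT L Mf o (siteT L Mf (RgV V))) (Q1 L Mf o) a')) 1 k))
      σB σX tow (fun g U k => rawA₀ g (C.transport U) k) W)
    (hΓB : ReadsTowerGammaB (fun (V : ↥dom) t k => Ψ t (pertCovC L Mf a ha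
      (balabanPert L Mf a (liftR L Mf (RgV V)) (gaugeSlot L Mf (RgV V) (QuT L Mf o (siteT L Mf (RgV V))) (Q1 L Mf o) a')) 1 k))
      σB σX tow rawB₀ W)
    (hdom₃ : GammaWeightDominatesDist 𝔄.F dist₃ σB σX (δ₃ / 2))
    -- the potential species
    {Λ₄ Λ₅ : ℝ} (hΛ₄ : 0 ≤ Λ₄) (hΛ₅ : 0 ≤ Λ₅)
    (hQ : PotQLipschitzReading (minActReadings d 𝒞 L N dom (ne2Loc L Mf fun V => liftR L Mf (RgV V))) 𝔄.F
      (fun g U k => rawA₀ g (C.transport U) k) rawB₀ W Λ₄)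
    (hR : PotRLipschitzReading (minActReadings d 𝒞 L N dom (ne2Loc L Mf fun V => liftR L Mf (RgV V))) 𝔄.F
      (fun g U k => rawA₀ g (C.transport U) k) rawB₀ W Λ₅)
    -- the rest of the END face, BY NAME from `B13StepEndArithmetic.exists_ne5_of_assembly_insOp`
    {ROp RHist : ℕ → ℝ} {aw : ℕ → ι → ℝ} {κ G EA₀ E₀ cA cB r₀ Gi δI θ' : ℝ} (rI : ℕ → ℝ) (hrI : ∀ k, 0 < rI k)
    (hT : 𝔄.TransportReads W)
    (hbB : 𝔄.SliceBudgetB W κ cB) (hbA : 𝔄.D.SliceBudget (𝔄.step (𝔄.bHist E₀ cB)) W κ cA)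
    (hdA : DecayBound (𝔄.outA (𝔄.bHist E₀ cB)) W EA₀ κ) (hdB : DecayBound (𝔄.outB (𝔄.bHist E₀ cB)) W E₀ κ)
    (hRA : RawBounded 𝔄.F 𝔄.rawAt W) (hRB : RawBounded 𝔄.F 𝔄.rawB W) (hfl : ∀ k, r₀ ≤ 𝔄.rOp k)
    (hienv : (𝔄.D.toInsOpModel (𝔄.step (𝔄.bHist E₀ cB)) rI hrI).InsOpEnvelope W κ E₀ Gi)
    (hibdA : (𝔄.D.toInsOpModel (𝔄.step (𝔄.bHist E₀ cB)) rI hrI).InsBoundA W κ E₀ Gi)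
    (hirate : (𝔄.D.toInsOpModel (𝔄.step (𝔄.bHist E₀ cB)) rI hrI).InsOpRate W δI (Real.sqrt (max θ ((L : ℝ)⁻¹))))
    (hδI : 0 ≤ δI) (hGi : 0 ≤ Gi)
    (hbd : TermBound (ballClass (selfCtr 𝔄.raw 𝔄.histRef) ROp RHist) (term 𝔄.𝒯 𝔄.inc 𝔄.act) W κ aw)
    (hbud : TermBudget aw G) (hline : TermLineAnalytic (ballClass (selfCtr 𝔄.raw 𝔄.histRef) ROp RHist) (term 𝔄.𝒯 𝔄.inc 𝔄.act) W)
    (hOp : ∀ k, 𝔄.rOp k ≤ ROp k) (hHist : ∀ k, 𝔄.bHist E₀ cB k + 𝔄.rHist k ≤ RHist k)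
    (hE₀ : 0 ≤ E₀) (hG : 0 ≤ G) (hcA : 0 ≤ cA) (hcB : 0 ≤ cB) (hr₀ : 0 < r₀)
    (hθθ' : Real.sqrt (max θ ((L : ℝ)⁻¹)) ≤ θ') (hθ'1 : θ' ≤ 1) (hω : 0 < 𝔄.D.ω) (hω1 : 𝔄.D.ω < 1)
    (hh : cA * (EA₀ + E₀) < 1 - 𝔄.D.ω)
    (hsmall : 𝔄.D.ω + G * cA * (1 - 𝔄.D.ω) / (1 - 𝔄.D.ω - cA * (EA₀ + E₀)) < θ') :
    ∃ C₅, NE5 (𝔄.outA (𝔄.bHist E₀ cB)) (𝔄.outB (𝔄.bHist E₀ cB)) W κ θ' C₅ := by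
  obtain ⟨hΘ0, hΘ1⟩ := sqrt_rate_pos_lt_one L hL hNE3.rate_lt_one
  have hwer : WeightedEntrywiseRate 𝔄.F 𝔄.rawAt 𝔄.rawB W
      (Real.sqrt (2 * B₁ * (2 * CpertRec o d L a α β Cn a' / (1 - max θ ((L : ℝ)⁻¹)))) +
          Real.sqrt (2 * B₂ * (Λ₂ * CpertRec o d L a α β Cn a')) + Real.sqrt (2 * B₃ * (Λ₃ * CpertRec o d L a α β Cn a')) +
          Λ₄ * Cn + Λ₅ * Cn)
      (fun k => Real.sqrt (max θ ((L : ℝ)⁻¹)) ^ k) := by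
    intro k g hg U e
    show ‖𝔄.rawA g (C.transport U) k e - 𝔄.rawB g U k e‖ ≤ _
    rw [hSA, hSB]
    exact weightedEntrywiseRate_balaban_ne3Shape' L Mf a ha hL hd hreg hα hβ hC hNE3 ha' hαη hβη hη hdec hcovA hcovB hdom₁ hΦ hΛ₂ hS₂
      hdecΦ hΔA hΔB hdom₂ hΨ hΛ₃ hS₃ hdecΨ hΓA hΓB hdom₃ hΛ₄ hΛ₅ hQ hR k g hg U e
  exact exists_ne5_of_assembly_insOp 𝔄 rI hrI hT hbB hbA hdA hdB hRA hRB hwer hfl hienv hibdA hirate hδI hGi hbd hbud hline hOp hHist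
    hE₀ hG hcA hcB (c1_balaban_nonneg L a hC hΛ₄ hΛ₅) hr₀ hΘ0 hΘ1 hθθ' hθ'1 hω hω1 hh hsmall

/-! ## §2 On Bałaban's paired-torus carriers OF RECORD: per pair of runs, and one constant for every pair of runs -/

/-- [folklore] **PER PAIR OF RUNS, ON THE CARRIERS OF RECORD**: `B13StepEndArithmetic.exists_ne5_of_record_insOp S E₀ cB` with `hwer` SUPPLIED BY NAME by the
owner's record face `weightedEntrywiseRate_record_balaban_ne3Shape` (slot lines `hSA`∕`hSB`, `NE3Shape`, class, threshold, O1 letters displayed instead) and `hc₁ ∕ hθ0 ∕ hθ1`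
discharged.  Conclusion LITERALLY `∃ C₅, T4OutputRate.NE5 (outA S E₀ cB) (outB S E₀ cB) W κ θ′ C₅`.  NOT a proof of NE5 ∕ NE2 ∕ NE3. -/
theorem exists_ne5_of_record_insOp_balaban_ne3Shape {𝔾 : Type} [GaugeGroup 𝔾] {R : TwoRuns 𝔾}
    (S : Slots R (Species Ts Ks Is Ωs Ys) IOp Hist) (E₀ cB : ℝ)
    {rawA₀ : (ℕ → ℝ) → R.carriers.BgA → ℕ → RawSpecies Ts Ks Is Ωs Ys} {rawB₀ : (ℕ → ℝ) → R.carriers.BgB → ℕ → RawSpecies Ts Ks Is Ωs Ys}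
    (hSA : ∀ g V k, S.rawA g V k = (rawA₀ g V k).kernel) (hSB : ∀ g U k, S.rawB g U k = (rawB₀ g U k).kernel) (hL : 2 ≤ L) (hd : 1 ≤ d)
    (hreg : ∀ V ∈ dom, RegularTransporters L Mf (liftR L Mf (RgV V)) α β) (hα : 0 ≤ α) (hβ : 0 ≤ β) (hC : 0 ≤ Cn)
    (hNE3 : NE3Shape (minActReadings d 𝒞 L N dom (ne2Loc L Mf fun V => liftR L Mf (RgV V))) Cn θ)
    (ha' : 0 < a') (hαη : α ≤ η) (hβη : β ≤ η) (hη : η ≤ etaStar o d a a')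
    {tow : ℕ → (ℕ → ℝ) → R.carriers.BgB → ↥dom} {W : Set (ℕ → ℝ)}
    {σ : Ts → Ks → idx L Mf 0 × o} {dist₁ : idx L Mf 0 × o → idx L Mf 0 × o → ℝ} {B₁ δ₁ : ℝ}
    (hdec : ∀ V ∈ dom, ∀ k, EntryDecay dist₁
      (pertCovC L Mf a ha (balabanPert L Mf a (liftR L Mf (RgV V)) (gaugeSlot L Mf (RgV V) (QuT L Mf o (siteT L Mf (RgV V))) (Q1 L Mf o) a'))
        1 k) B₁ δ₁)
    (hcovA : ReadsTowerCovA
      (fun V : ↥dom => pertCovC L Mf a ha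
        (balabanPert L Mf a (liftR L Mf (RgV V)) (gaugeSlot L Mf (RgV V) (QuT L Mf o (siteT L Mf (RgV V))) (Q1 L Mf o) a')) 1)
      σ tow (fun g U k => rawA₀ g (R.carriers.transport U) k) W)
    (hcovB : ReadsTowerCovB
      (fun V : ↥dom => pertCovC L Mf a ha
        (balabanPert L Mf a (liftR L Mf (RgV V)) (gaugeSlot L Mf (RgV V) (QuT L Mf o (siteT L Mf (RgV V))) (Q1 L Mf o) a')) 1)
      σ tow rawB₀ W)
    (hdom₁ : CovWeightDominatesDist S.F dist₁ σ (δ₁ / 2))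
    {S₂ : Set (Matrix (idx L Mf 0 × o) (idx L Mf 0 × o) ℂ)} {Φ : Ts → Matrix (idx L Mf 0 × o) (idx L Mf 0 × o) ℂ → Matrix m m ℂ}
    {Λ₂ : ℝ} (hΦ : ∀ t, OpLipschitzOn S₂ (Φ t) Λ₂) (hΛ₂ : 0 ≤ Λ₂)
    (hS₂ : ∀ V ∈ dom, ∀ k, pertCovC L Mf a ha
      (balabanPert L Mf a (liftR L Mf (RgV V)) (gaugeSlot L Mf (RgV V) (QuT L Mf o (siteT L Mf (RgV V))) (Q1 L Mf o) a')) 1 k ∈ S₂)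
    {dist₂ : m → m → ℝ} {B₂ δ₂ : ℝ}
    (hdecΦ : ∀ V ∈ dom, ∀ t k, EntryDecay dist₂ (Φ t (pertCovC L Mf a ha
      (balabanPert L Mf a (liftR L Mf (RgV V)) (gaugeSlot L Mf (RgV V) (QuT L Mf o (siteT L Mf (RgV V))) (Q1 L Mf o) a')) 1 k)) B₂ δ₂)
    {σX : Ts → Is → m}
    (hΔA : ReadsTowerDeltaA (fun (V : ↥dom) t k => Φ t (pertCovC L Mf a ha
      (balabanPert L Mf a (liftR L Mf (RgV V)) (gaugeSlot L Mf (RgV V) (QuT L Mf o (siteT L Mf (RgV V))) (Q1 L Mf o) a')) 1 k))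
      σX tow (fun g U k => rawA₀ g (R.carriers.transport U) k) W)
    (hΔB : ReadsTowerDeltaB (fun (V : ↥dom) t k => Φ t (pertCovC L Mf a ha
      (balabanPert L Mf a (liftR L Mf (RgV V)) (gaugeSlot L Mf (RgV V) (QuT L Mf o (siteT L Mf (RgV V))) (Q1 L Mf o) a')) 1 k))
      σX tow rawB₀ W)
    (hdom₂ : DeltaWeightDominatesDist S.F dist₂ σX (δ₂ / 2))
    {S₃ : Set (Matrix (idx L Mf 0 × o) (idx L Mf 0 × o) ℂ)} {Ψ : Ts → Matrix (idx L Mf 0 × o) (idx L Mf 0 × o) ℂ → Matrix m m ℂ}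
    {Λ₃ : ℝ} (hΨ : ∀ t, OpLipschitzOn S₃ (Ψ t) Λ₃) (hΛ₃ : 0 ≤ Λ₃)
    (hS₃ : ∀ V ∈ dom, ∀ k, pertCovC L Mf a ha
      (balabanPert L Mf a (liftR L Mf (RgV V)) (gaugeSlot L Mf (RgV V) (QuT L Mf o (siteT L Mf (RgV V))) (Q1 L Mf o) a')) 1 k ∈ S₃)
    {dist₃ : m → m → ℝ} {B₃ δ₃ : ℝ}
    (hdecΨ : ∀ V ∈ dom, ∀ t k, EntryDecay dist₃ (Ψ t (pertCovC L Mf a ha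
      (balabanPert L Mf a (liftR L Mf (RgV V)) (gaugeSlot L Mf (RgV V) (QuT L Mf o (siteT L Mf (RgV V))) (Q1 L Mf o) a')) 1 k)) B₃ δ₃)
    {σB : Ts → Ks → m}
    (hΓA : ReadsTowerGammaA (fun (V : ↥dom) t k => Ψ t (pertCovC L Mf a ha
      (balabanPert L Mf a (liftR L Mf (RgV V)) (gaugeSlot L Mf (RgV V) (QuT L Mf o (siteT L Mf (RgV V))) (Q1 L Mf o) a')) 1 k))
      σB σX tow (fun g U k => rawA₀ g (R.carriers.transport U) k) W)
    (hΓB : ReadsTowerGammaB (fun (V : ↥dom) t k => Ψ t (pertCovC L Mf a ha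
      (balabanPert L Mf a (liftR L Mf (RgV V)) (gaugeSlot L Mf (RgV V) (QuT L Mf o (siteT L Mf (RgV V))) (Q1 L Mf o) a')) 1 k))
      σB σX tow rawB₀ W)
    (hdom₃ : GammaWeightDominatesDist S.F dist₃ σB σX (δ₃ / 2))
    {Λ₄ Λ₅ : ℝ} (hΛ₄ : 0 ≤ Λ₄) (hΛ₅ : 0 ≤ Λ₅)
    (hQ : PotQLipschitzReading (minActReadings d 𝒞 L N dom (ne2Loc L Mf fun V => liftR L Mf (RgV V))) S.F
      (fun g U k => rawA₀ g (R.carriers.transport U) k) rawB₀ W Λ₄)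
    (hR : PotRLipschitzReading (minActReadings d 𝒞 L N dom (ne2Loc L Mf fun V => liftR L Mf (RgV V))) S.F
      (fun g U k => rawA₀ g (R.carriers.transport U) k) rawB₀ W Λ₅)
    {ROp RHist : ℕ → ℝ} {aw : ℕ → TermIdx R.carriers.Dom (Bnd R) → ℝ} {κ G EA₀ cA r₀ Gi δI θ' : ℝ} (rI : ℕ → ℝ)
    (hrI : ∀ k, 0 < rI k)
    (hT : (assembly S).TransportReads W)
    (hbB : (assembly S).SliceBudgetB W κ cB) (hbA : S.D.SliceBudget (step S E₀ cB) W κ cA)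
    (hdA : DecayBound (outA S E₀ cB) W EA₀ κ) (hdB : DecayBound (outB S E₀ cB) W E₀ κ)
    (hRA : RawBounded S.F (assembly S).rawAt W) (hRB : RawBounded S.F S.rawB W) (hfl : ∀ k, r₀ ≤ S.rOp k)
    (hienv : (S.D.toInsOpModel (step S E₀ cB) rI hrI).InsOpEnvelope W κ E₀ Gi)
    (hibdA : (S.D.toInsOpModel (step S E₀ cB) rI hrI).InsBoundA W κ E₀ Gi)
    (hirate : (S.D.toInsOpModel (step S E₀ cB) rI hrI).InsOpRate W δI (Real.sqrt (max θ ((L : ℝ)⁻¹))))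
    (hδI : 0 ≤ δI) (hGi : 0 ≤ Gi)
    (hbd : TermBound (ballClass (selfCtr (assembly S).raw (assembly S).histRef) ROp RHist)
      (term (assembly S).𝒯 (assembly S).inc S.act) W κ aw)
    (hbud : TermBudget aw G)
    (hline : TermLineAnalytic (ballClass (selfCtr (assembly S).raw (assembly S).histRef) ROp RHist)
      (term (assembly S).𝒯 (assembly S).inc S.act) W)
    (hOp : ∀ k, S.rOp k ≤ ROp k) (hHist : ∀ k, (assembly S).bHist E₀ cB k + S.rHist k ≤ RHist k)
    (hE₀ : 0 ≤ E₀) (hG : 0 ≤ G) (hcA : 0 ≤ cA) (hcB : 0 ≤ cB) (hr₀ : 0 < r₀)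
    (hθθ' : Real.sqrt (max θ ((L : ℝ)⁻¹)) ≤ θ') (hθ'1 : θ' ≤ 1) (hω : 0 < S.D.ω) (hω1 : S.D.ω < 1)
    (hh : cA * (EA₀ + E₀) < 1 - S.D.ω)
    (hsmall : S.D.ω + G * cA * (1 - S.D.ω) / (1 - S.D.ω - cA * (EA₀ + E₀)) < θ') :
    ∃ C₅, NE5 (outA S E₀ cB) (outB S E₀ cB) W κ θ' C₅ :=
  exists_ne5_of_record_insOp S E₀ cB rI hrI hT hbB hbA hdA hdB hRA hRB
    (weightedEntrywiseRate_record_balaban_ne3Shape L Mf a ha S hSA hSB hL hd hreg hα hβ hC hNE3 ha' hαη hβη hη hdec hcovA hcovB hdom₁ hΦ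
      hΛ₂ hS₂ hdecΦ hΔA hΔB hdom₂ hΨ hΛ₃ hS₃ hdecΨ hΓA hΓB hdom₃ hΛ₄ hΛ₅ hQ hR)
    hfl hienv hibdA hirate hδI hGi hbd hbud hline hOp hHist hE₀ hG hcA hcB (c1_balaban_nonneg L a hC hΛ₄ hΛ₅) hr₀
    (sqrt_rate_pos_lt_one L hL hNE3.rate_lt_one).1 (sqrt_rate_pos_lt_one L hL hNE3.rate_lt_one).2 hθθ' hθ'1 hω hω1 hh hsmall

/-- [folklore] **ONE CONSTANT FOR EVERY PAIR OF RUNS (η-UNIFORMITY), W1 PRODUCED AT BAŁABAN's TIER-B BACKGROUND, LETTERS ELIMINATED** —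
`B13StepEndArithmetic.uniform_ne5_of_record_insOp` with its W1 binder supplied per pair of runs by the owner's record face.  Fix the SIZES (`κ, G, EA₀, E₀, cA, cB,
r₀, Gi, δI, θ′, ω`, the letters of W1's constant `o, d, L, a, α, β, Cn, a′, B₁, B₂, B₃, Λ₂, …, Λ₅`, and U1b's `θ < 1` — here a SIZE, since `C₅` is chosen before the
data), subject to `√(max θ L⁻¹) ≤ θ′ ≤ 1` and the TWO STRICT SIZE INEQUALITIES.  Then ONE `C₅` serves EVERY pair of runs `R : TwoRuns 𝔾`, slot package `S` (species
format `S.F`, `S.D.ω = ω`), admissible data `dom ∕ 𝒞 ∕ N ∕ RgV` in the (3.35)-class and in U1b's shape `NE3Shape … Cn θ`, species tables `rawA₀ ∕ rawB₀` (slot lines),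
towers `tow` over `R.carriers.BgB`, O1 letters, window, margins, roomy class: the displayed binders IMPLY `NE5 (outA S E₀ cB) (outB S E₀ cB) W κ θ′ C₅`.  NOT a proof of
NE5 ∕ NE2 ∕ NE3: an implication from displayed binders, the quantifier order `∃ C₅, ∀ …` being the point. -/
theorem uniform_ne5_of_record_insOp_balaban_ne3Shape (hL : 2 ≤ L) (hd : 1 ≤ d) (hα : 0 ≤ α) (hβ : 0 ≤ β) (hC : 0 ≤ Cn) (ha' : 0 < a')
    (hαη : α ≤ η) (hβη : β ≤ η) (hη : η ≤ etaStar o d a a') {B₁ B₂ B₃ Λ₂ Λ₃ Λ₄ Λ₅ : ℝ} (hΛ₂ : 0 ≤ Λ₂) (hΛ₃ : 0 ≤ Λ₃)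
    (hΛ₄ : 0 ≤ Λ₄) (hΛ₅ : 0 ≤ Λ₅) (hθ1 : θ < 1) {κ G EA₀ E₀ cA cB r₀ Gi δI θ' ω : ℝ}
    (hE₀ : 0 ≤ E₀) (hG : 0 ≤ G) (hcA : 0 ≤ cA) (hcB : 0 ≤ cB) (hr₀ : 0 < r₀) (hGi : 0 ≤ Gi) (hδI : 0 ≤ δI)
    (hθθ' : Real.sqrt (max θ ((L : ℝ)⁻¹)) ≤ θ') (hθ'1 : θ' ≤ 1) (hω : 0 < ω) (hω1 : ω < 1)
    (hh : cA * (EA₀ + E₀) < 1 - ω) (hsmall : ω + G * cA * (1 - ω) / (1 - ω - cA * (EA₀ + E₀)) < θ') :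
    ∃ C₅ : ℝ, ∀ {𝔾 : Type} [GaugeGroup 𝔾] {R : TwoRuns 𝔾} {IOp' Hist' : Type*} [NormedAddCommGroup Hist'] [NormedSpace ℂ Hist']
      [CompleteSpace Hist'] [NormedAddCommGroup IOp'] [NormedSpace ℂ IOp']
      (S : Slots R (Species Ts Ks Is Ωs Ys) IOp' Hist')
      {𝒞 : ℕ → Set (B7Prop1Explicit.Site d → Fin d → (Matrix o o ℂ)ˣ)} {N : ℕ}
      {dom : Set (B7Prop1Explicit.Site d → Fin d → (Matrix o o ℂ)ˣ)}
      {RgV : (B7Prop1Explicit.Site d → Fin d → (Matrix o o ℂ)ˣ) → ((k : ℕ) → Fin d → (Tor (fine (lev L k) Mf) → Matrix o o ℂ))}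
      {rawA₀ : (ℕ → ℝ) → R.carriers.BgA → ℕ → RawSpecies Ts Ks Is Ωs Ys} {rawB₀ : (ℕ → ℝ) → R.carriers.BgB → ℕ → RawSpecies Ts Ks Is Ωs Ys}
      {tow : ℕ → (ℕ → ℝ) → R.carriers.BgB → ↥dom} {W : Set (ℕ → ℝ)}
      {σ : Ts → Ks → idx L Mf 0 × o} {dist₁ : idx L Mf 0 × o → idx L Mf 0 × o → ℝ} {δ₁ : ℝ}
      {S₂ : Set (Matrix (idx L Mf 0 × o) (idx L Mf 0 × o) ℂ)} {Φ : Ts → Matrix (idx L Mf 0 × o) (idx L Mf 0 × o) ℂ → Matrix m m ℂ}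
      {dist₂ : m → m → ℝ} {δ₂ : ℝ} {σX : Ts → Is → m}
      {S₃ : Set (Matrix (idx L Mf 0 × o) (idx L Mf 0 × o) ℂ)} {Ψ : Ts → Matrix (idx L Mf 0 × o) (idx L Mf 0 × o) ℂ → Matrix m m ℂ}
      {dist₃ : m → m → ℝ} {δ₃ : ℝ} {σB : Ts → Ks → m}
      {ROp RHist : ℕ → ℝ} {aw : ℕ → TermIdx R.carriers.Dom (Bnd R) → ℝ} (rI : ℕ → ℝ) (hrI : ∀ k, 0 < rI k),
      S.D.ω = ω →
      (∀ V ∈ dom, RegularTransporters L Mf (liftR L Mf (RgV V)) α β) →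
      NE3Shape (minActReadings d 𝒞 L N dom (ne2Loc L Mf fun V => liftR L Mf (RgV V))) Cn θ →
      (∀ g V k, S.rawA g V k = (rawA₀ g V k).kernel) → (∀ g U k, S.rawB g U k = (rawB₀ g U k).kernel) →
      (∀ V ∈ dom, ∀ k, EntryDecay dist₁
        (pertCovC L Mf a ha (balabanPert L Mf a (liftR L Mf (RgV V)) (gaugeSlot L Mf (RgV V) (QuT L Mf o (siteT L Mf (RgV V))) (Q1 L Mf o) a'))
          1 k) B₁ δ₁) →
      ReadsTowerCovA
        (fun V : ↥dom => pertCovC L Mf a ha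
          (balabanPert L Mf a (liftR L Mf (RgV V)) (gaugeSlot L Mf (RgV V) (QuT L Mf o (siteT L Mf (RgV V))) (Q1 L Mf o) a')) 1)
        σ tow (fun g U k => rawA₀ g (R.carriers.transport U) k) W →
      ReadsTowerCovB
        (fun V : ↥dom => pertCovC L Mf a ha
          (balabanPert L Mf a (liftR L Mf (RgV V)) (gaugeSlot L Mf (RgV V) (QuT L Mf o (siteT L Mf (RgV V))) (Q1 L Mf o) a')) 1)
        σ tow rawB₀ W →
      CovWeightDominatesDist S.F dist₁ σ (δ₁ / 2) →
      (∀ t, OpLipschitzOn S₂ (Φ t) Λ₂) →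
      (∀ V ∈ dom, ∀ k, pertCovC L Mf a ha
        (balabanPert L Mf a (liftR L Mf (RgV V)) (gaugeSlot L Mf (RgV V) (QuT L Mf o (siteT L Mf (RgV V))) (Q1 L Mf o) a')) 1 k ∈ S₂) →
      (∀ V ∈ dom, ∀ t k, EntryDecay dist₂ (Φ t (pertCovC L Mf a ha
        (balabanPert L Mf a (liftR L Mf (RgV V)) (gaugeSlot L Mf (RgV V) (QuT L Mf o (siteT L Mf (RgV V))) (Q1 L Mf o) a')) 1 k)) B₂ δ₂) →
      ReadsTowerDeltaA (fun (V : ↥dom) t k => Φ t (pertCovC L Mf a ha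
        (balabanPert L Mf a (liftR L Mf (RgV V)) (gaugeSlot L Mf (RgV V) (QuT L Mf o (siteT L Mf (RgV V))) (Q1 L Mf o) a')) 1 k))
        σX tow (fun g U k => rawA₀ g (R.carriers.transport U) k) W →
      ReadsTowerDeltaB (fun (V : ↥dom) t k => Φ t (pertCovC L Mf a ha
        (balabanPert L Mf a (liftR L Mf (RgV V)) (gaugeSlot L Mf (RgV V) (QuT L Mf o (siteT L Mf (RgV V))) (Q1 L Mf o) a')) 1 k))
        σX tow rawB₀ W →
      DeltaWeightDominatesDist S.F dist₂ σX (δ₂ / 2) →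
      (∀ t, OpLipschitzOn S₃ (Ψ t) Λ₃) →
      (∀ V ∈ dom, ∀ k, pertCovC L Mf a ha
        (balabanPert L Mf a (liftR L Mf (RgV V)) (gaugeSlot L Mf (RgV V) (QuT L Mf o (siteT L Mf (RgV V))) (Q1 L Mf o) a')) 1 k ∈ S₃) →
      (∀ V ∈ dom, ∀ t k, EntryDecay dist₃ (Ψ t (pertCovC L Mf a ha
        (balabanPert L Mf a (liftR L Mf (RgV V)) (gaugeSlot L Mf (RgV V) (QuT L Mf o (siteT L Mf (RgV V))) (Q1 L Mf o) a')) 1 k)) B₃ δ₃) →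
      ReadsTowerGammaA (fun (V : ↥dom) t k => Ψ t (pertCovC L Mf a ha
        (balabanPert L Mf a (liftR L Mf (RgV V)) (gaugeSlot L Mf (RgV V) (QuT L Mf o (siteT L Mf (RgV V))) (Q1 L Mf o) a')) 1 k))
        σB σX tow (fun g U k => rawA₀ g (R.carriers.transport U) k) W →
      ReadsTowerGammaB (fun (V : ↥dom) t k => Ψ t (pertCovC L Mf a ha
        (balabanPert L Mf a (liftR L Mf (RgV V)) (gaugeSlot L Mf (RgV V) (QuT L Mf o (siteT L Mf (RgV V))) (Q1 L Mf o) a')) 1 k))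
        σB σX tow rawB₀ W →
      GammaWeightDominatesDist S.F dist₃ σB σX (δ₃ / 2) →
      PotQLipschitzReading (minActReadings d 𝒞 L N dom (ne2Loc L Mf fun V => liftR L Mf (RgV V))) S.F
        (fun g U k => rawA₀ g (R.carriers.transport U) k) rawB₀ W Λ₄ →
      PotRLipschitzReading (minActReadings d 𝒞 L N dom (ne2Loc L Mf fun V => liftR L Mf (RgV V))) S.F
        (fun g U k => rawA₀ g (R.carriers.transport U) k) rawB₀ W Λ₅ →
      (assembly S).TransportReads W →
      (assembly S).SliceBudgetB W κ cB → S.D.SliceBudget (step S E₀ cB) W κ cA →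
      DecayBound (outA S E₀ cB) W EA₀ κ → DecayBound (outB S E₀ cB) W E₀ κ →
      RawBounded S.F (assembly S).rawAt W → RawBounded S.F S.rawB W → (∀ k, r₀ ≤ S.rOp k) →
      (S.D.toInsOpModel (step S E₀ cB) rI hrI).InsOpEnvelope W κ E₀ Gi →
      (S.D.toInsOpModel (step S E₀ cB) rI hrI).InsBoundA W κ E₀ Gi →
      (S.D.toInsOpModel (step S E₀ cB) rI hrI).InsOpRate W δI (Real.sqrt (max θ ((L : ℝ)⁻¹))) →
      TermBound (ballClass (selfCtr (assembly S).raw (assembly S).histRef) ROp RHist)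
        (term (assembly S).𝒯 (assembly S).inc S.act) W κ aw →
      TermBudget aw G →
      TermLineAnalytic (ballClass (selfCtr (assembly S).raw (assembly S).histRef) ROp RHist)
        (term (assembly S).𝒯 (assembly S).inc S.act) W →
      (∀ k, S.rOp k ≤ ROp k) → (∀ k, (assembly S).bHist E₀ cB k + S.rHist k ≤ RHist k) →
      NE5 (outA S E₀ cB) (outB S E₀ cB) W κ θ' C₅ := by
  obtain ⟨hΘ0, hΘ1⟩ := sqrt_rate_pos_lt_one L hL hθ1
  obtain ⟨C₅, hC₅⟩ := B13StepEndArithmetic.uniform_ne5_of_record_insOp (κ := κ)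
    (c₁ := Real.sqrt (2 * B₁ * (2 * CpertRec o d L a α β Cn a' / (1 - max θ ((L : ℝ)⁻¹)))) +
      Real.sqrt (2 * B₂ * (Λ₂ * CpertRec o d L a α β Cn a')) + Real.sqrt (2 * B₃ * (Λ₃ * CpertRec o d L a α β Cn a')) +
      Λ₄ * Cn + Λ₅ * Cn)
    hE₀ hG hcA hcB (c1_balaban_nonneg L a hC hΛ₄ hΛ₅) hr₀ hGi hδI hΘ0 hΘ1 hθθ' hθ'1 hω hω1 hh hsmall
  refine ⟨C₅, ?_⟩
  intro 𝔾 _ R IOp' Hist' _ _ _ _ _ S 𝒞 N dom RgV rawA₀ rawB₀ tow W σ dist₁ δ₁ S₂ Φ dist₂ δ₂ σX S₃ Ψ dist₃ δ₃ σB ROp RHist aw rI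
    hrI hSω hreg hNE3 hSA hSB hdec hcovA hcovB hdom₁ hΦ hS₂ hdecΦ hΔA hΔB hdom₂ hΨ hS₃ hdecΨ hΓA hΓB hdom₃ hQ hR hT hbB hbA hdA
    hdB hRA hRB hfl hienv hibdA hirate hbd hbud hline hOp hHist
  have hwer := weightedEntrywiseRate_record_balaban_ne3Shape L Mf a ha S hSA hSB hL hd hreg hα hβ hC hNE3 ha' hαη hβη hη hdec hcovA hcovB
    hdom₁ hΦ hΛ₂ hS₂ hdecΦ hΔA hΔB hdom₂ hΨ hΛ₃ hS₃ hdecΨ hΓA hΓB hdom₃ hΛ₄ hΛ₅ hQ hR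
  exact hC₅ S rI hrI hSω hT hbB hbA hdA hdB hRA hRB hwer hfl hienv hibdA hirate hbd hbud hline hOp hHist

end Balaban

end Summit.QuantumFields.BalabanUV.T4Continuum.B13StepEndInsOpBalaban

end
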